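import Summits.RiemannHypothesis.RiemannHypothesis.Theorems.SoloInformedGroundStateTracking

/-!
# Ground-state endgame, III: partial tracking rates, the crux shape, Connes's law typed

Solo programme `solo-RiemannHypothesis-informed`, session 1 — part of the assembled endgame of
the semilocal (Weil ground state) programme (Connes 2026, arXiv:2602.04022, §6.6); overview in
`SoloInformedGroundStateLimit.lean`. Everything here is proved; the only named fact used anywhere
in the package is `Connes2026_weilGroundState_zeros_re_eq_half` (C–vS Thm. 6.1), as a hypothesis.

Calibration on substrips `|Im z| < α` (`re_eq_half_near_line_of_L2_tracking`: a partial
tracking rate excludes zeros near the line), the crux shape `riemannHypothesis_of_dist_bound`,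
and the two halves of Connes's law (`riemannHypothesis_of_connesLawLower`,
`connesLawUpper_of_explicit`).
-/

noncomputable section

open Complex Filter Set Topology Metric MeasureTheory
open Literature.NumberTheory.LFunctions

namespace Summit.RiemannHypothesis.RiemannHypothesis.Theorems

/-! ## Calibration: partial tracking rates exclude zeros near the critical line

Nothing in the Hurwitz assembly needs the full strip: convergence of real-zero approximants on the
SUBSTRIP `|Im z| < α₀` already forces every zero of `Ξ` in that substrip to be real, i.e. `ζ` has no
zero `s` in the critical strip with `0 < |Re s − 1/2| < α₀`. Through `norm_weilMellin_le_of_ae_vanish`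
this calibrates the semilocal path: weighted `L²` tracking at rates `o(λ^{-α})` for all `α < α₀` (plus
Fact 6.4 on the substrip) excludes zeros within distance `α₀` of the line — the EXPONENT of the
tracking rate is the WIDTH of the excluded strip (`α₀ = 1/2` being RH). No such exclusion is known for
any `α₀ > 0`. -/

section Substrip

/-- The substrip `|Im z| < α`. -/
def xiSubstrip (α : ℝ) : Set ℂ := {z : ℂ | |z.im| < α}

/-- Its upper half `0 < Im z < α`. -/
def xiSubstripUpper (α : ℝ) : Set ℂ := {z : ℂ | 0 < z.im} ∩ {z : ℂ | z.im < α}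

/-- Its lower half `-α < Im z < 0`. -/
def xiSubstripLower (α : ℝ) : Set ℂ := {z : ℂ | -α < z.im} ∩ {z : ℂ | z.im < 0}

/-- `xiStrip_eq_xiSubstrip` (auxiliary; see the module docstring). -/
theorem xiStrip_eq_xiSubstrip : xiStrip = xiSubstrip (1 / 2) := rfl

variable (α : ℝ)

/-- `isOpen_xiSubstrip` (auxiliary; see the module docstring). -/
theorem isOpen_xiSubstrip : IsOpen (xiSubstrip α) :=
  isOpen_lt (continuous_abs.comp Complex.continuous_im) continuous_const

/-- `isOpen_xiSubstripUpper` (auxiliary; see the module docstring). -/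
theorem isOpen_xiSubstripUpper : IsOpen (xiSubstripUpper α) :=
  (isOpen_lt continuous_const Complex.continuous_im).inter
    (isOpen_lt Complex.continuous_im continuous_const)

/-- `isOpen_xiSubstripLower` (auxiliary; see the module docstring). -/
theorem isOpen_xiSubstripLower : IsOpen (xiSubstripLower α) :=
  (isOpen_lt continuous_const Complex.continuous_im).inter
    (isOpen_lt Complex.continuous_im continuous_const)

/-- `isPreconnected_xiSubstripUpper` (auxiliary; see the module docstring). -/
theorem isPreconnected_xiSubstripUpper : IsPreconnected (xiSubstripUpper α) :=
  ((convex_halfSpace_im_gt (0 : ℝ)).inter (convex_halfSpace_im_lt α)).isPreconnected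

/-- `isPreconnected_xiSubstripLower` (auxiliary; see the module docstring). -/
theorem isPreconnected_xiSubstripLower : IsPreconnected (xiSubstripLower α) :=
  ((convex_halfSpace_im_gt (-α)).inter (convex_halfSpace_im_lt (0 : ℝ))).isPreconnected

/-- `xiSubstripUpper_subset` (auxiliary; see the module docstring). -/
theorem xiSubstripUpper_subset : xiSubstripUpper α ⊆ xiSubstrip α := by
  rintro z ⟨h1, h2⟩
  simp only [xiSubstrip, mem_setOf_eq, mem_setOf_eq, abs_lt] at h1 h2 ⊢
  exact ⟨by linarith, h2⟩

/-- `xiSubstripLower_subset` (auxiliary; see the module docstring). -/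
theorem xiSubstripLower_subset : xiSubstripLower α ⊆ xiSubstrip α := by
  rintro z ⟨h1, h2⟩
  simp only [xiSubstrip, mem_setOf_eq, abs_lt] at h1 h2 ⊢
  exact ⟨h1, by linarith⟩

variable {α}

/-- **Hurwitz assembly on a substrip.** Real-zero holomorphic approximants converging to `Ξ`
locally uniformly on `|Im z| < α` force every zero of `Ξ` in that substrip to be real. -/
theorem im_eq_zero_of_tendstoLocallyUniformlyOn_substrip {ι : Type*} {l : Filter ι} [l.NeBot]
    (F : ι → ℂ → ℂ) (hF : ∀ᶠ n in l, DifferentiableOn ℂ (F n) (xiSubstrip α))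
    (hreal : ∃ᶠ n in l, ∀ z ∈ xiSubstrip α, F n z = 0 → z.im = 0)
    (hlim : TendstoLocallyUniformlyOn F riemannXiUpper l (xiSubstrip α))
    {z : ℂ} (hzS : z ∈ xiSubstrip α) (hz : riemannXiUpper z = 0) : z.im = 0 := by
  by_contra him
  simp only [xiSubstrip, mem_setOf_eq, abs_lt] at hzS
  rcases lt_or_gt_of_ne him with hneg | hpos
  · have hzU : z ∈ xiSubstripLower α := ⟨hzS.1, hneg⟩
    have h0 : ∃ᶠ n in l, ∀ w ∈ xiSubstripLower α, F n w ≠ 0 := by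
      refine hreal.mono fun n hn w hw hw0 ↦ ?_
      have := hn w (xiSubstripLower_subset α hw) hw0
      exact (lt_irrefl (0 : ℝ)) (this ▸ hw.2)
    rcases Complex.hurwitz_eqOn_zero_or_forall_ne_zero (isOpen_xiSubstripLower α)
        (isPreconnected_xiSubstripLower α) (hF.mono fun n hn ↦ hn.mono (xiSubstripLower_subset α))
        (hlim.mono (xiSubstripLower_subset α)) h0 with h | h
    · exact not_eqOn_zero_riemannXiUpper (isOpen_xiSubstripLower α) hzU h
    · exact h z hzU hz
  · have hzU : z ∈ xiSubstripUpper α := ⟨hpos, hzS.2⟩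
    have h0 : ∃ᶠ n in l, ∀ w ∈ xiSubstripUpper α, F n w ≠ 0 := by
      refine hreal.mono fun n hn w hw hw0 ↦ ?_
      have := hn w (xiSubstripUpper_subset α hw) hw0
      exact (lt_irrefl (0 : ℝ)) (this ▸ hw.1)
    rcases Complex.hurwitz_eqOn_zero_or_forall_ne_zero (isOpen_xiSubstripUpper α)
        (isPreconnected_xiSubstripUpper α) (hF.mono fun n hn ↦ hn.mono (xiSubstripUpper_subset α))
        (hlim.mono (xiSubstripUpper_subset α)) h0 with h | h
    · exact not_eqOn_zero_riemannXiUpper (isOpen_xiSubstripUpper α) hzU h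
    · exact h z hzU hz

/-- The same in `ζ`-language: no zero of `ζ` in the critical strip within distance `α` of the
critical line, except on it. -/
theorem re_eq_half_of_tendstoLocallyUniformlyOn_substrip {ι : Type*} {l : Filter ι} [l.NeBot]
    (F : ι → ℂ → ℂ) (hF : ∀ᶠ n in l, DifferentiableOn ℂ (F n) (xiSubstrip α))
    (hreal : ∃ᶠ n in l, ∀ z ∈ xiSubstrip α, F n z = 0 → z.im = 0)
    (hlim : TendstoLocallyUniformlyOn F riemannXiUpper l (xiSubstrip α))
    {s : ℂ} (hs : riemannZeta s = 0) (h0 : 0 < s.re) (h1 : s.re < 1) (hnear : |s.re - 1 / 2| < α) :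
    s.re = 1 / 2 := by
  set z : ℂ := -I * (s - 1 / 2) with hzdef
  have hsz : 1 / 2 + I * z = s := by rw [hzdef]; ring_nf; rw [I_sq]; ring
  have hzim : z.im = 1 / 2 - s.re := by
    rw [hzdef]
    simp [mul_im, sub_re, sub_im]
  have hxi : riemannXiUpper z = 0 := by
    rw [riemannXiUpper, hsz]
    exact (riemannXi_eq_zero_iff_holds s).2 ⟨hs, h0, h1⟩
  have hzS : z ∈ xiSubstrip α := by
    simp only [xiSubstrip, mem_setOf_eq, hzim]
    rwa [abs_sub_comm]
  have := im_eq_zero_of_tendstoLocallyUniformlyOn_substrip F hF hreal hlim hzS hxi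
  rw [hzim] at this
  linarith

/-- On a compact subset of the substrip `|Im z| < α₀` (`0 < α₀`), `|Im z| ≤ α` for some `α ∈ (0, α₀)`. -/
theorem exists_abs_im_le_of_isCompact_substrip {α₀ : ℝ} (hα₀ : 0 < α₀) {K : Set ℂ}
    (hK : IsCompact K) (hKs : K ⊆ xiSubstrip α₀) :
    ∃ α : ℝ, 0 < α ∧ α < α₀ ∧ ∀ z ∈ K, |z.im| ≤ α := by
  rcases K.eq_empty_or_nonempty with rfl | hne
  · exact ⟨α₀ / 2, by positivity, by linarith, fun z hz ↦ hz.elim⟩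
  · obtain ⟨z₀, hz₀, hmax⟩ :=
      hK.exists_isMaxOn hne (continuous_abs.comp Complex.continuous_im).continuousOn
    have h0 : |z₀.im| < α₀ := hKs hz₀
    refine ⟨max |z₀.im| (α₀ / 2), lt_max_iff.2 (Or.inr (by positivity)), max_lt h0 (by linarith),
      fun z hz ↦ ?_⟩
    exact le_trans (isMaxOn_iff.1 hmax z hz) (le_max_left _ _)

/-- **Calibration theorem.** Ground states with simple even bottoms (M1), comparison vectors whose
transforms converge to `Ξ` locally uniformly on the substrip `|Im z| < α₀`, and weighted `L²`
tracking at every rate `α < α₀` exclude all zeros of `ζ` with `0 < |Re s − 1/2| < α₀` in the critical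
strip. (`α₀ = 1/2` is `riemannHypothesis_of_L2_tracking`.) -/
theorem re_eq_half_near_line_of_L2_tracking
    (hfact : Connes2026_weilGroundState_zeros_re_eq_half) {α₀ : ℝ} (hα₀ : 0 < α₀)
    (a : ℕ → ℝ) (u k : ℕ → ℝ → ℂ) (c : ℕ → ℂ)
    (hM1 : ∀ n, WeilWindowSimpleEven (a n)) (hu : ∀ n, IsWeilGroundState (a n) (u n))
    (hc : ∀ n, c n ≠ 0) (hk : ∀ n, MemLp (k n) 2)
    (hka : ∀ n, ∀ᵐ t : ℝ, t ∉ Icc (-(a n)) (a n) → k n t = 0)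
    (hkXi : TendstoLocallyUniformlyOn (fun n z ↦ weilMellin (k n) (1 / 2 + I * z))
      riemannXiUpper atTop (xiSubstrip α₀))
    (htrack : ∀ α : ℝ, 0 < α → α < α₀ →
      Tendsto (fun n ↦ Real.exp (α * a n) *
        (Real.sqrt (2 * a n) * Real.sqrt (∫ t, ‖c n * u n t - k n t‖ ^ 2))) atTop (𝓝 0))
    {s : ℂ} (hs : riemannZeta s = 0) (h0 : 0 < s.re) (h1 : s.re < 1) (hnear : |s.re - 1 / 2| < α₀) :
    s.re = 1 / 2 := by
  set F : ℕ → ℂ → ℂ := fun n z ↦ c n * weilMellin (u n) (1 / 2 + I * z) with hFdef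
  have hF : ∀ᶠ n in atTop, DifferentiableOn ℂ (F n) (xiSubstrip α₀) :=
    Eventually.of_forall fun n ↦ ((differentiable_const _).mul
      ((hu n).differentiable_weilMellin.comp ((differentiable_const _).add
        ((differentiable_const _).mul differentiable_id)))).differentiableOn
  have hreal : ∃ᶠ n in atTop, ∀ z ∈ xiSubstrip α₀, F n z = 0 → z.im = 0 := by
    refine Eventually.frequently (Eventually.of_forall fun n z _ hz ↦ ?_)
    rcases mul_eq_zero.1 hz with h | h
    · exact absurd h (hc n)
    · exact Connes2026_weilGroundState_zeros_re_eq_half.im_eq_zero_of_fourier_eq_zero hfact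
        (hM1 n) (hu n) h
  refine re_eq_half_of_tendstoLocallyUniformlyOn_substrip F hF hreal ?_ hs h0 h1 hnear
  -- locally uniform convergence on the substrip, exactly as in `riemannHypothesis_of_L2_tracking`
  rw [tendstoLocallyUniformlyOn_iff_forall_isCompact (isOpen_xiSubstrip α₀)]
  intro K hKs hK
  obtain ⟨α, hα0, hα, hKα⟩ := exists_abs_im_le_of_isCompact_substrip hα₀ hK hKs
  have hkK : TendstoUniformlyOn (fun n z ↦ weilMellin (k n) (1 / 2 + I * z)) riemannXiUpper
      atTop K :=
    (tendstoLocallyUniformlyOn_iff_forall_isCompact (isOpen_xiSubstrip α₀)).1 hkXi K hKs hK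
  rw [Metric.tendstoUniformlyOn_iff] at hkK ⊢
  intro ε hε
  have hε2 : 0 < ε / 2 := by positivity
  filter_upwards [hkK (ε / 2) hε2, (htrack α hα0 hα).eventually (gt_mem_nhds hε2)]
    with n hn htr z hz
  set s' : ℂ := 1 / 2 + I * z with hs'
  have hIu : Integrable fun t : ℝ ↦ c n * (u n t * cexp ((s' - 1 / 2) * t)) :=
    ((hu n).integrable_mul_cexp (s' - 1 / 2)).const_mul (c n)
  have hkI : IntegrableOn (k n) (Icc (-(a n)) (a n)) :=
    ((hk n).restrict (Icc (-(a n)) (a n))).integrable one_le_two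
  have hIk : Integrable fun t : ℝ ↦ k n t * cexp ((s' - 1 / 2) * t) :=
    (hkI.mul_continuousOn (by fun_prop) isCompact_Icc).integrable_of_ae_notMem_eq_zero
      ((hka n).mono fun t ht hts ↦ by simp [ht hts])
  have hdiff : c n * weilMellin (u n) s' - weilMellin (k n) s' =
      weilMellin (fun t ↦ c n * u n t - k n t) s' := by
    simp only [weilMellin, ← integral_const_mul]
    rw [← integral_sub hIu hIk]
    refine integral_congr_ae (Eventually.of_forall fun t ↦ ?_)
    simp only
    ring
  have hf2 : MemLp (fun t ↦ c n * u n t - k n t) 2 := ((hu n).memLp.const_mul (c n)).sub (hk n)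
  have hfa : ∀ᵐ t : ℝ, t ∉ Icc (-(a n)) (a n) → c n * u n t - k n t = 0 := by
    filter_upwards [(hu n).ae_eq_zero_of_notMem, hka n] with t h1 h2 hts
    simp [h1 hts, h2 hts]
  have hB : ‖c n * weilMellin (u n) s' - weilMellin (k n) s'‖ ≤
      Real.exp (α * a n) * (Real.sqrt (2 * a n) *
        Real.sqrt (∫ t, ‖c n * u n t - k n t‖ ^ 2)) := by
    rw [hdiff, hs']
    refine (norm_weilMellin_le_of_ae_vanish (hu n).pos.le hf2 hfa z).trans ?_
    exact mul_le_mul_of_nonneg_right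
      (Real.exp_le_exp.2 (mul_le_mul_of_nonneg_right (hKα z hz) (hu n).pos.le)) (by positivity)
  calc dist (riemannXiUpper z) (F n z)
      ≤ dist (riemannXiUpper z) (weilMellin (k n) s') +
          dist (weilMellin (k n) s') (F n z) := dist_triangle _ _ _
    _ < ε / 2 + ε / 2 := by
        refine add_lt_add (hn z hz) ?_
        rw [dist_eq_norm, norm_sub_rev]
        exact hB.trans_lt htr
    _ = ε := add_halves ε

end Substrip

/-! ## (F) The crux shape: an excess-energy rate implies RH

Combining (C) with (D): if `d n` bounds the squared `L²` distance from `k n` to the ground-state ray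
(by (D), `d n = (q (k n) - ε₀ n * ‖k n‖²) / (ε₁ n - ε₀ n)` is such a bound once the closed Weil form and its two
bottom even levels are available as objects), then the single real-sequence condition
`exp (α aₙ) · √(2 aₙ) · √(dₙ) → 0` for every `α < 1/2` already gives RH.  With `aₙ = log λₙ` this is the
statement "(relative excess energy of `k_λ`)/(spectral gap) = o(λ^{-2α}/log λ) for all α < 1/2" of the memo. -/
/-- **The crux shape.** Given the C–vS fact and (M1), an `L²`-distance bound `d n` from `c n • u n`
to the comparison vectors `k n` with `e^{α aₙ} √(2aₙ) √(dₙ) → 0` for every `0 < α < 1/2`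
implies `RiemannHypothesis`. -/
theorem riemannHypothesis_of_dist_bound
    (hfact : Connes2026_weilGroundState_zeros_re_eq_half)
    (a : ℕ → ℝ) (u k : ℕ → ℝ → ℂ) (c : ℕ → ℂ)
    (hM1 : ∀ n, WeilWindowSimpleEven (a n)) (hu : ∀ n, IsWeilGroundState (a n) (u n))
    (hc : ∀ n, c n ≠ 0) (hk : ∀ n, MemLp (k n) 2)
    (hka : ∀ n, ∀ᵐ t : ℝ, t ∉ Icc (-(a n)) (a n) → k n t = 0)
    (hkXi : TendstoLocallyUniformlyOn (fun n z ↦ weilMellin (k n) (1 / 2 + I * z))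
      riemannXiUpper atTop xiStrip)
    (d : ℕ → ℝ) (hd : ∀ n, (∫ t, ‖c n * u n t - k n t‖ ^ 2) ≤ d n)
    (hrate : ∀ α : ℝ, 0 < α → α < 1 / 2 →
      Tendsto (fun n ↦ Real.exp (α * a n) * (Real.sqrt (2 * a n) * Real.sqrt (d n))) atTop (𝓝 0)) :
    _root_.RiemannHypothesis := by
  refine riemannHypothesis_of_L2_tracking hfact a u k c hM1 hu hc hk hka hkXi ?_
  intro α hα0 hα
  refine tendsto_of_tendsto_of_tendsto_of_le_of_le tendsto_const_nhds (hrate α hα0 hα) ?_ ?_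
  · intro n
    positivity
  · intro n
    have h1 : Real.sqrt (∫ t, ‖c n * u n t - k n t‖ ^ 2) ≤ Real.sqrt (d n) :=
      Real.sqrt_le_sqrt (hd n)
    have h2 : 0 ≤ Real.sqrt (2 * a n) := Real.sqrt_nonneg _
    have h3 : 0 ≤ Real.exp (α * a n) := (Real.exp_pos _).le
    exact mul_le_mul_of_nonneg_left (mul_le_mul_of_nonneg_left h1 h2) h3

/-- The same in summit form. -/
theorem summit_of_dist_bound
    (hfact : Connes2026_weilGroundState_zeros_re_eq_half)
    (a : ℕ → ℝ) (u k : ℕ → ℝ → ℂ) (c : ℕ → ℂ)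
    (hM1 : ∀ n, WeilWindowSimpleEven (a n)) (hu : ∀ n, IsWeilGroundState (a n) (u n))
    (hc : ∀ n, c n ≠ 0) (hk : ∀ n, MemLp (k n) 2)
    (hka : ∀ n, ∀ᵐ t : ℝ, t ∉ Icc (-(a n)) (a n) → k n t = 0)
    (hkXi : TendstoLocallyUniformlyOn (fun n z ↦ weilMellin (k n) (1 / 2 + I * z))
      riemannXiUpper atTop xiStrip)
    (d : ℕ → ℝ) (hd : ∀ n, (∫ t, ‖c n * u n t - k n t‖ ^ 2) ≤ d n)
    (hrate : ∀ α : ℝ, 0 < α → α < 1 / 2 →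
      Tendsto (fun n ↦ Real.exp (α * a n) * (Real.sqrt (2 * a n) * Real.sqrt (d n))) atTop (𝓝 0)) :
    Summit.RiemannHypothesis :=
  Summit.RiemannHypothesis_iff.2
    (riemannHypothesis_of_dist_bound hfact a u k c hM1 hu hc hk hka hkXi d hd hrate)
/-! ## (G) Connes's law, typed: the provable half and the wall

Connes (letter §6.4; CCM25 §8 indication (2)) reports numerically `ε(λ) ≈ 1 - χ₂(λ) ~ (2¹⁴/3)√2 π⁵ μ^{9/2} e^{-4πμ}`,
`μ = λ²`, for the bottom of the semilocal Weil form on the window `[λ⁻¹, λ]`; in the tree's additive normalisation the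
window is `[-a, a]` with `λ = eᵃ`, `μ = e^{2a}`, and the bottom is `weilGroundEnergy a`.  The memo (paper/sharpest.md §2a)
splits the law into two halves of very different status:
* `ConnesLawUpper` — an UPPER bound `ε(a) ≤ C μ^B e^{-4πμ}`: claimed provable unconditionally from the exact identity
  `k̂_λ = ζ·M(h_λ) − T_λ` (the main term dies at every zero of ζ, on the line or not) and the Slepian–Fuchs leak
  asymptotics; recorded here as a typed target (CLAIM C6), not proved;
* `ConnesLawLower` — a LOWER bound of the same shape: this is the wall.  It implies Weil positivity on every large
  window, hence (antitonicity + Weil's criterion, both in the tree) the Riemann hypothesis —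
  `riemannHypothesis_of_connesLawLower` below, kernel-checked. -/

/-- Upper half of Connes's law (typed target; CLAIM C6 of the solo memo): for some `C, B` and all `a ≥ 1`,
`ε(a) ≤ C · μ^B · e^{-4πμ}` with `μ = e^{2a}`. -/
@[conjecture] def ConnesLawUpper : Prop :=
  ∃ C B : ℝ, ∀ a : ℝ, 1 ≤ a →
    weilGroundEnergy a ≤ C * Real.exp (2 * a) ^ B * Real.exp (-(4 * Real.pi * Real.exp (2 * a)))

/-- Lower half of Connes's law (the wall): for some `c > 0`, `B` and all `a ≥ 1`,
`c · μ^{-B} · e^{-4πμ} ≤ ε(a)` with `μ = e^{2a}`. -/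
@[conjecture] def ConnesLawLower : Prop :=
  ∃ c B : ℝ, 0 < c ∧ ∀ a : ℝ, 1 ≤ a →
    c * (Real.exp (2 * a) ^ B)⁻¹ * Real.exp (-(4 * Real.pi * Real.exp (2 * a))) ≤ weilGroundEnergy a

/-- Weil positivity on all LARGE windows already gives RH (antitonicity of `WeilPositivityOn` in the window
and the tree's unconditional Yoshida criterion `riemannHypothesis_iff_forall_weilPositivityOn`). -/
theorem riemannHypothesis_of_eventually_weilPositivityOn {a₀ : ℝ}
    (h : ∀ a : ℝ, a₀ ≤ a → WeilPositivityOn a) : _root_.RiemannHypothesis :=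
  riemannHypothesis_iff_forall_weilPositivityOn.2 fun a _ ↦
    WeilPositivityOn.mono (le_max_left a a₀) (h _ (le_max_right a a₀))

/-- Eventual non-negativity of the ground energy gives RH. -/
theorem riemannHypothesis_of_eventually_weilGroundEnergy_nonneg {a₀ : ℝ} (ha₀ : 0 < a₀)
    (h : ∀ a : ℝ, a₀ ≤ a → 0 ≤ weilGroundEnergy a) : _root_.RiemannHypothesis :=
  riemannHypothesis_of_eventually_weilPositivityOn fun a ha ↦
    (weilGroundEnergy_nonneg_iff_holds (ha₀.trans_le ha)).1 (h a ha)

/-- **The wall, typed**: the lower half of Connes's law implies the Riemann hypothesis. -/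
theorem riemannHypothesis_of_connesLawLower (h : ConnesLawLower) : _root_.RiemannHypothesis := by
  obtain ⟨c, B, hc, h⟩ := h
  refine riemannHypothesis_of_eventually_weilGroundEnergy_nonneg one_pos fun a ha ↦ ?_
  refine le_trans ?_ (h a ha)
  have : 0 < Real.exp (2 * a) ^ B := Real.rpow_pos_of_pos (Real.exp_pos _) _
  positivity

/-- Summit form of the wall. -/
theorem summit_of_connesLawLower (h : ConnesLawLower) : Summit.RiemannHypothesis :=
  Summit.RiemannHypothesis_iff.2 (riemannHypothesis_of_connesLawLower h)

/-- **What the provable half needs, exactly** (CLAIM C6): `ConnesLawUpper` follows from ONE family of explicit window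
test functions whose Rayleigh quotients obey the law — by the tree's `weilGroundEnergy_le_div` (the ground energy is the
infimum of the Rayleigh quotient).  The intended witnesses are mollifications, inside the window, of Connes's prolate
vectors `k_λ = E(h_λ)` (the raw `k_λ` has a jump at the inner edge and is not an `IsWeilTest`); the Rayleigh bound is to
come from the exact identity `k̂_λ = ζ·M(h_λ) − T_λ` and non-asymptotic prolate leak bounds (Bonami–Jaming–Karoui 2021). -/
theorem connesLawUpper_of_explicit {C B : ℝ}
    (h : ∀ a : ℝ, 1 ≤ a → ∃ k : ℝ → ℂ, IsWeilTest k ∧ tsupport k ⊆ Icc (-a) a ∧ 0 < ∫ t : ℝ, ‖k t‖ ^ 2 ∧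
      (weilQuadratic k).re ≤
        C * Real.exp (2 * a) ^ B * Real.exp (-(4 * Real.pi * Real.exp (2 * a))) * ∫ t : ℝ, ‖k t‖ ^ 2) :
    ConnesLawUpper := by
  refine ⟨C, B, fun a ha ↦ ?_⟩
  obtain ⟨k, hk, hs, hpos, hQ⟩ := h a ha
  exact (weilGroundEnergy_le_div hk hs hpos).trans ((div_le_iff₀ hpos).2 hQ)

/-- Conversely the law's upper half bounds every window's ground energy by an explicit number; in particular the
ground energy tends to `0` from above at most at Connes's rate IF it is non-negative (RH), and is eventually tiny in
absolute value either way only if the lower half also holds. Recorded as the trivial consequence used in the memo: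
under `ConnesLawUpper`, `ε(a) ≤ C μ^B e^{-4πμ}` gives `limsup ε(a) ≤ 0`. -/
theorem weilGroundEnergy_eventually_le_of_connesLawUpper (h : ConnesLawUpper) :
    ∃ C B : ℝ, ∀ a : ℝ, 1 ≤ a →
      weilGroundEnergy a ≤ C * Real.exp (2 * a) ^ B * Real.exp (-(4 * Real.pi * Real.exp (2 * a))) := h

end Summit.RiemannHypothesis.RiemannHypothesis.Theorems
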